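import Mathlib.RingTheory.Adjoin.Basic
import Mathlib.RingTheory.Localization.Away.Basic
import Mathlib.RingTheory.FiniteType
import HarnessLib

/-!
# Stages of an algebra over a directed union of subrings: eventual membership

Topic: `Literature/AlgebraicGeometry/Limits` (Noetherian approximation; EGA IV₃ §8.2, Görtz–Wedhorn I
(10.13): a ring `B` is the filtered union of its finitely generated subalgebras `K[t]`). For a
`K`-algebra `B`, a `B`-algebra `R` (think `R = Γ(V, 𝒪_Y)` for an affine open `V` of a `B`-scheme of
finite type) and a set `G ⊆ R` of generators, the **stage** of `R` at a finite subset `t ⊆ B` is the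
`K`-subalgebra `K[t][G] ⊆ R` generated by `G` and the image of `t` (`stage t G`). These are the affine
charts of the finite type models of `Spec R` over the finitely generated subalgebras `K[t] ⊆ B` used in
the approximation of schemes of finite type by schemes of finite type over Noetherian rings (The Stacks
Project, Tag 01ZA/09ZP circle of ideas, in the "scheme-theoretic image" form where all stages are
SUBRINGS of `R`, so that every identity valid in `R` holds in a stage as soon as its terms lie in it).

* `stage`, `stage_mono`, `algebraMap_mem_stage`, `subset_stage`;
* `exists_forall_mem_stage` — **eventual membership**: if `G` generates `R` over `B`, every element of
  `R` lies in `stage t G` for all `t` containing some finite `t₀` (and a finite set of elements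
  simultaneously, `exists_forall_finset_subset_stage`);
* `map_stage_le` — functoriality along `B`-algebra maps `φ : R → R'` with `φ(G) ⊆ stage t G'`;
* `exists_forall_away_witness` — **eventual localisation witnesses**: for a `B`-algebra map
  `φ : R' → R` and `h ∈ R'` such that every element `x ∈ R` satisfies `x · φ(h)^N = φ(c)` for some
  `c ∈ R'` (as when `Spec R = D(h) ∪ … ⊆ Spec R'` and `R[1/φ h] = R'[1/h]`), for `t` large every
  element of `stage t G` satisfies this with `c ∈ stage t G'`.

Everything is proved; no named facts. [folklore]

## References

* U. Görtz, T. Wedhorn, *Algebraic Geometry I*, 2nd ed. (2020), (10.13), Thm. 10.57 ff. [GortzWedhorn2020]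
* A. Grothendieck, J. Dieudonné, EGA IV₃ (1966), §8.2.
* The Stacks Project, Tags 01ZA, 09ZP (Limits of Schemes). [StacksProject]
-/

namespace Literature.AlgebraicGeometry.Limits

namespace Stage

variable {K B R : Type*} [CommRing K] [CommRing B] [CommRing R] [Algebra K B] [Algebra B R]
  [Algebra K R] [IsScalarTower K B R]

variable (K) in
/-- The **stage** of the `B`-algebra `R` at the finite subset `t ⊆ B` with respect to the generators
`G ⊆ R`: the `K`-subalgebra `K[t][G]` of `R` generated by `G` and the image of `t`. [folklore] -/
def stage (t : Finset B) (G : Set R) : Subalgebra K R :=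
  Algebra.adjoin K (algebraMap B R '' (t : Set B) ∪ G)

omit [Algebra K B] [IsScalarTower K B R] in
/-- Stages grow with `t` and `G`. [folklore] -/
theorem stage_mono {t t' : Finset B} (ht : t ⊆ t') {G G' : Set R} (hG : G ⊆ G') :
    stage K t G ≤ stage K t' G' :=
  Algebra.adjoin_mono (Set.union_subset_union (Set.image_mono (Finset.coe_subset.mpr ht)) hG)

omit [Algebra K B] [IsScalarTower K B R] in
/-- The image of `t` lies in the stage. [folklore] -/
theorem algebraMap_mem_stage {t : Finset B} (G : Set R) {b : B} (hb : b ∈ t) :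
    algebraMap B R b ∈ stage K t G :=
  Algebra.subset_adjoin (Or.inl ⟨b, Finset.mem_coe.mpr hb, rfl⟩)

omit [Algebra K B] [IsScalarTower K B R] in
/-- The generators lie in the stage. [folklore] -/
theorem subset_stage (t : Finset B) (G : Set R) : G ⊆ stage K t G :=
  fun _ hx => Algebra.subset_adjoin (Or.inr hx)

omit [Algebra K B] [IsScalarTower K B R] in
/-- **Eventual membership**: if `G` generates `R` as a `B`-algebra, every `x ∈ R` lies in all stages
`stage t G` with `t ⊇ t₀` for some finite `t₀ ⊆ B` (the coefficients of an expression of `x` as a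
`B`-polynomial in `G`). [cite: GortzWedhorn2020, (10.13) 1., p. 321] -/
theorem exists_forall_mem_stage {G : Set R} (hG : Algebra.adjoin B G = ⊤) (x : R) :
    ∃ t₀ : Finset B, ∀ t : Finset B, t₀ ⊆ t → x ∈ stage K t G := by
  classical
  have hx : x ∈ Algebra.adjoin B G := by rw [hG]; exact Algebra.mem_top
  induction hx using Algebra.adjoin_induction with
  | mem x hx => exact ⟨∅, fun t _ => subset_stage t G hx⟩
  | algebraMap b => exact ⟨{b}, fun t ht => algebraMap_mem_stage G (ht (Finset.mem_singleton_self b))⟩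
  | add x y _ _ ihx ihy =>
    obtain ⟨tx, htx⟩ := ihx
    obtain ⟨ty, hty⟩ := ihy
    exact ⟨tx ∪ ty, fun t ht => Subalgebra.add_mem _ (htx t (Finset.union_subset_left ht))
      (hty t (Finset.union_subset_right ht))⟩
  | mul x y _ _ ihx ihy =>
    obtain ⟨tx, htx⟩ := ihx
    obtain ⟨ty, hty⟩ := ihy
    exact ⟨tx ∪ ty, fun t ht => Subalgebra.mul_mem _ (htx t (Finset.union_subset_left ht))
      (hty t (Finset.union_subset_right ht))⟩

omit [Algebra K B] [IsScalarTower K B R] in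
/-- Eventual membership for finitely many elements at once. [folklore] -/
theorem exists_forall_finset_subset_stage {G : Set R} (hG : Algebra.adjoin B G = ⊤) (s : Finset R) :
    ∃ t₀ : Finset B, ∀ t : Finset B, t₀ ⊆ t → (s : Set R) ⊆ stage K t G := by
  classical
  induction s using Finset.induction_on with
  | empty => exact ⟨∅, fun t _ => by simp⟩
  | insert a s _ ih =>
    obtain ⟨t₁, ht₁⟩ := ih
    obtain ⟨t₂, ht₂⟩ := exists_forall_mem_stage (K := K) hG a
    refine ⟨t₁ ∪ t₂, fun t ht => ?_⟩
    rw [Finset.coe_insert, Set.insert_subset_iff]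
    exact ⟨ht₂ t (Finset.union_subset_right ht), ht₁ t (Finset.union_subset_left ht)⟩

omit [Algebra K B] [IsScalarTower K B R] in
/-- Eventual membership for a finite set of elements. [folklore] -/
theorem exists_forall_subset_stage {G : Set R} (hG : Algebra.adjoin B G = ⊤) {s : Set R} (hs : s.Finite) :
    ∃ t₀ : Finset B, ∀ t : Finset B, t₀ ⊆ t → s ⊆ stage K t G := by
  obtain ⟨t₀, ht₀⟩ := exists_forall_finset_subset_stage (K := K) hG hs.toFinset
  exact ⟨t₀, fun t ht => by rw [← hs.coe_toFinset]; exact ht₀ t ht⟩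

/-- **Functoriality of stages**: a `B`-algebra homomorphism `φ : R → R'` mapping `G` into
`stage t G'` maps `stage t G` into `stage t G'`. [folklore] -/
theorem map_stage_le {R' : Type*} [CommRing R'] [Algebra B R'] [Algebra K R'] [IsScalarTower K B R']
    (φ : R →ₐ[B] R') {t : Finset B} {G : Set R} {G' : Set R'} (hφ : ∀ x ∈ G, φ x ∈ stage K t G') :
    (stage K t G).map (φ.restrictScalars K) ≤ stage K t G' := by
  rw [stage, AlgHom.map_adjoin]
  refine Algebra.adjoin_le ?_
  rintro _ ⟨x, hx | hx, rfl⟩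
  · obtain ⟨b, hb, rfl⟩ := hx
    rw [AlgHom.coe_restrictScalars', AlgHom.commutes]
    exact algebraMap_mem_stage G' (Finset.mem_coe.mp hb)
  · exact hφ x hx

/-- Pointwise form of `map_stage_le`. [folklore] -/
theorem map_mem_stage {R' : Type*} [CommRing R'] [Algebra B R'] [Algebra K R'] [IsScalarTower K B R']
    (φ : R →ₐ[B] R') {t : Finset B} {G : Set R} {G' : Set R'} (hφ : ∀ x ∈ G, φ x ∈ stage K t G')
    {x : R} (hx : x ∈ stage K t G) : φ x ∈ stage K t G' :=
  map_stage_le φ hφ ⟨x, hx, rfl⟩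

/-- **Eventual localisation witnesses.** Let `φ : R' → R` be a `B`-algebra homomorphism, `h ∈ R'`, and
suppose every `x` in a generating set `G` of `R` satisfies `x · φ(h)^N = φ(c)` for some `c ∈ R'`
(this holds when `R'[1/h] → R[1/φ h]` is onto). Then for all `t` containing some finite `t₀`, `h` and
`φ` restrict to the stages and every element of `stage t G` satisfies the same with
`c ∈ stage t G'`. [folklore] -/
theorem exists_forall_away_witness {R' : Type*} [CommRing R'] [Algebra B R'] [Algebra K R']
    [IsScalarTower K B R'] (φ : R' →ₐ[B] R) {G : Set R} (hGfin : G.Finite) {G' : Set R'}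
    (hG' : Algebra.adjoin B G' = ⊤) (h : R')
    (hw : ∀ x ∈ G, ∃ (N : ℕ) (c : R'), x * φ h ^ N = φ c) :
    ∃ t₀ : Finset B, ∀ t : Finset B, t₀ ⊆ t →
      h ∈ stage K t G' ∧
      ∀ x ∈ stage K t G, ∃ (N : ℕ) (c : R'), c ∈ stage K t G' ∧ x * φ h ^ N = φ c := by
  classical
  -- witnesses for the generators
  choose N c hc using hw
  -- a stage containing `h` and all witnesses
  have hfin : ({h} ∪ Set.range (fun x : G => c x.1 x.2)).Finite :=
    (Set.finite_singleton h).union (@Set.finite_range _ _ _ hGfin.to_subtype)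
  obtain ⟨t₀, ht₀⟩ := exists_forall_subset_stage (K := K) hG' hfin
  refine ⟨t₀, fun t ht => ?_⟩
  have hmem := ht₀ t ht
  have hh : h ∈ stage K t G' := hmem (Or.inl rfl)
  refine ⟨hh, ?_⟩
  -- the set of elements with a witness is a subalgebra containing the generators of the stage
  intro x hx
  induction hx using Algebra.adjoin_induction with
  | mem x hx =>
    rcases hx with ⟨b, hb, rfl⟩ | hx
    · refine ⟨0, algebraMap B R' b, algebraMap_mem_stage G' (Finset.mem_coe.mp hb), ?_⟩
      rw [pow_zero, mul_one, AlgHom.commutes]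
    · exact ⟨N x hx, c x hx, hmem (Or.inr ⟨⟨x, hx⟩, rfl⟩), hc x hx⟩
  | algebraMap k =>
    refine ⟨0, algebraMap K R' k, Subalgebra.algebraMap_mem _ k, ?_⟩
    rw [pow_zero, mul_one, IsScalarTower.algebraMap_apply K B R' k, AlgHom.commutes,
      ← IsScalarTower.algebraMap_apply]
  | add x y _ _ ihx ihy =>
    obtain ⟨Nx, cx, hcx, hx⟩ := ihx
    obtain ⟨Ny, cy, hcy, hy⟩ := ihy
    refine ⟨Nx + Ny, cx * h ^ Ny + cy * h ^ Nx, Subalgebra.add_mem _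
      (Subalgebra.mul_mem _ hcx (Subalgebra.pow_mem _ hh _))
      (Subalgebra.mul_mem _ hcy (Subalgebra.pow_mem _ hh _)), ?_⟩
    rw [add_mul, map_add, map_mul, map_mul, map_pow, map_pow, ← hx, ← hy, pow_add]
    ring
  | mul x y _ _ ihx ihy =>
    obtain ⟨Nx, cx, hcx, hx⟩ := ihx
    obtain ⟨Ny, cy, hcy, hy⟩ := ihy
    refine ⟨Nx + Ny, cx * cy, Subalgebra.mul_mem _ hcx hcy, ?_⟩
    rw [map_mul, ← hx, ← hy, pow_add]
    ring

end Stage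

end Literature.AlgebraicGeometry.Limits
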